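import Literature.NumberTheory.Transcendental.LcmOfConsecutiveIntegers
import Literature.NumberTheory.Transcendental.ZetaLinearFormsCriterion
import Mathlib.NumberTheory.Chebyshev
import Mathlib.NumberTheory.Harmonic.Bounds
import Mathlib.Analysis.SpecialFunctions.Pow.Asymptotics
import Mathlib.Data.Nat.Factorization.Basic
import Mathlib.Algebra.GCDMonoid.FinsetLemmas
import Mathlib.Tactic
import HarnessLib

/-!
# The lcm of consecutive integers `L_{n,k} = [n−k, …, n]` (CDT Lemma 48) via the PNT

Calegari–Dimitrov–Tang, arXiv:2408.15403, §5 (pp. 43–44), Lemma 48: for `k ∈ [0, n]`,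
`γ := k/n`, `L_{n,k} := lcm(n−k, n−k+1, …, n)`:
(1) for fixed rational `γ ∈ (0,1]`, `log L_{n,k} = (Σ_{h=1}^{⌊1/γ⌋−1} 1/h) k + ⌊1/γ⌋⁻¹ n + o(n)`;
(2) for every `ε > 0` there is `N(ε)` with
`log L_{n,k} ≤ (Σ_{h=1}^{⌊1/γ⌋−1} 1/h) k + ⌊1/γ⌋⁻¹ n + ε n` for all `n > N(ε)` and all
`k ∈ [0, n]`. The printed proof: "If `p > k` is a prime, then `p` divides at most one of the
integers in `[n−k, n]` … the main term in `[1,…,n]` (after taking log) is `Σ_{p≤n} log p` (we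
may count primes without multiplicities). The only primes `p ≤ n` not occurring in this count
are those that admit an `a ∈ ℕ` such that `ap < n − k` and `(a+1)p > n` … there are
asymptotically `((n−k)/a − n/(a+1) + o(1)) (log n)⁻¹` such primes, and the asymptotic … follows
by a simple calculation [the prime number theorem]."

This file proves (2) and the two-sided (1) — uniformly in `k` — following the printed argument: `log L ≤ θ_L + (ψ(n) − θ(n))` (prime powers), `θ_L ≤ θ(n) − Σ_{a<q} (θ((n−k)/a − 1)
− θ(n/(a+1)))` (the gap primes do not divide `L`, and the gaps are disjoint), and
`θ(x) = x + o(x)` (the prime number theorem `ψ(x) ∼ x` of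
`Literature…ZetaLinearFormsCriterion.tendsto_psi_div` with Mathlib's
`Chebyshev.psi_sub_theta_le`), uniformly for `⌊n/k⌋ ≤ Q` since all evaluation points are
`≥ n/Q − 1`; the range `⌊n/k⌋ > Q` is reduced to `k' = ⌊n/(Q+1)⌋ + 1` by monotonicity in `k`,
with main term `≤ ((1 + log Q)/(Q+1) + 1/Q) n ≤ ε n/2` for `Q` large.

* `thetaOf L = Σ_{p | L} log p`; `log_lcmIcc_le_thetaOf_add` (prime-power bookkeeping).
* `not_dvd_lcmIcc_of_gap`, `gapPrimes`, `thetaOf_lcmIcc_le` (the sieve bound).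
* `eventually_theta_le_mul`, `eventually_mul_le_theta` — `θ(x) ∼ x`.
* `log_lcmIcc_le` — **Lemma 48, upper bound, uniformly for `⌊n/k⌋ ≤ Q`**.
* `log_lcmIcc_le_uniform` — **Lemma 48 (2)**: uniformly for all `0 ≤ k ≤ n`.
* `exists_gap_of_not_dvd`, `theta_sub_le_thetaOf_lcmIcc` (the reverse sieve), `le_log_lcmIcc`,
  `mainTerm_le_of_lt`, `le_log_lcmIcc_uniform` — **Lemma 48 (1), lower half**: uniformly for
  all `0 ≤ k < n`, `main − ε n ≤ log L_{n,k}`; hence `log L_{n,k} = main + o(n)` uniformly.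

No named facts.

## References

* [CalegariDimitrovTang2024] arXiv:2408.15403, §5 Lemma 48, Basic Remark 49 (pp. 43–44).
-/

noncomputable section

open Real

namespace Literature.NumberTheory.Transcendental

namespace CalegariDimitrovTang

/-- `θ_L := Σ_{p | L prime} log p`, the logarithm of the radical of `L`. [folklore] -/
def thetaOf (L : ℕ) : ℝ := ∑ p ∈ L.primeFactors, Real.log p

/-- `lcm(a,…,n) ∣ lcm(1,…,n)` for `1 ≤ a`. [folklore] -/
theorem lcmIcc_dvd_lcmUpto {a n : ℕ} (ha : 1 ≤ a) : lcmIcc a n ∣ Nat.lcmUpto n := by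
  unfold lcmIcc Nat.lcmUpto
  refine Finset.lcm_dvd fun m hm => ?_
  obtain ⟨hma, hmn⟩ := Finset.mem_Icc.mp hm
  exact Finset.dvd_lcm (Finset.mem_Icc.mpr ⟨by omega, hmn⟩)

/-- The prime factors of `lcm(a,…,n)` are primes `≤ n`. [folklore] -/
theorem primeFactors_lcmIcc_subset {a n : ℕ} (ha : 1 ≤ a) :
    (lcmIcc a n).primeFactors ⊆ Nat.primesLE n := by
  intro p hp
  have h := Nat.primeFactors_mono (lcmIcc_dvd_lcmUpto (n := n) ha) (Nat.lcmUpto_ne_zero n) hp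
  rwa [Nat.primeFactors_lcmUpto] at h

/-- **Prime-power bookkeeping**: `log lcm(a,…,n) ≤ θ_L + (ψ(n) − θ(n))` — the multiplicity of
`p` in the lcm is at most `⌊log_p n⌋`, and `ψ(n) − θ(n) = Σ_{p ≤ n} (⌊log_p n⌋ − 1) log p`.
[cite: CalegariDimitrovTang2024, §5 proof of Lemma 48: "the main term in [1,…,n] (after taking log) is given by Σ_{p≤n} log p (i.e., we may just count primes without counting multiplicities)" (p. 43)] -/
theorem log_lcmIcc_le_thetaOf_add {a n : ℕ} (ha : 1 ≤ a) :
    Real.log (lcmIcc a n) ≤ thetaOf (lcmIcc a n) + (Chebyshev.psi n - Chebyshev.theta n) := by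
  set L := lcmIcc a n with hL
  have hL0 : L ≠ 0 := lcmIcc_ne_zero ha
  -- `log L = Σ_{p | L} v_p(L) log p`
  have hlog : Real.log L = ∑ p ∈ L.primeFactors, (L.factorization p : ℝ) * Real.log p := by
    rw [Real.log_nat_eq_sum_factorization L, Finsupp.sum]
    rfl
  -- `v_p(L) ≤ ⌊log_p n⌋`
  have hv : ∀ p ∈ L.primeFactors, L.factorization p ≤ Nat.log p n := by
    intro p hp
    have hpp : p.Prime := Nat.prime_of_mem_primeFactors hp
    have := (Nat.factorization_le_iff_dvd hL0 (Nat.lcmUpto_ne_zero n)).mpr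
      (lcmIcc_dvd_lcmUpto (n := n) ha) p
    rwa [Nat.factorization_lcmUpto n hpp] at this
  -- `ψ(n) − θ(n) = Σ_{p ≤ n} (⌊log_p n⌋ − 1) log p ≥ Σ_{p | L} (v_p − 1) log p`
  have hψθ : Chebyshev.psi n - Chebyshev.theta n =
      ∑ p ∈ Nat.primesLE n, ((Nat.log p n : ℝ) - 1) * Real.log p := by
    rw [Chebyshev.psi_eq_sum_mul_log_prime, Chebyshev.theta_eq_sum_primesLE_log,
      ← Finset.sum_sub_distrib]
    exact Finset.sum_congr rfl fun p _ => by ring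
  rw [hlog, hψθ, thetaOf]
  have hsub := primeFactors_lcmIcc_subset (n := n) ha
  calc ∑ p ∈ L.primeFactors, (L.factorization p : ℝ) * Real.log p
      ≤ ∑ p ∈ L.primeFactors, (Real.log p + ((Nat.log p n : ℝ) - 1) * Real.log p) := by
        refine Finset.sum_le_sum fun p hp => ?_
        have h1 : (L.factorization p : ℝ) ≤ Nat.log p n := by exact_mod_cast hv p hp
        have h2 : 0 ≤ Real.log p := Real.log_natCast_nonneg p
        nlinarith
    _ = ∑ p ∈ L.primeFactors, Real.log p +
        ∑ p ∈ L.primeFactors, ((Nat.log p n : ℝ) - 1) * Real.log p := Finset.sum_add_distrib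
    _ ≤ ∑ p ∈ L.primeFactors, Real.log p +
        ∑ p ∈ Nat.primesLE n, ((Nat.log p n : ℝ) - 1) * Real.log p := by
        have hle : ∑ p ∈ L.primeFactors, ((Nat.log p n : ℝ) - 1) * Real.log p ≤
            ∑ p ∈ Nat.primesLE n, ((Nat.log p n : ℝ) - 1) * Real.log p := by
          refine Finset.sum_le_sum_of_subset_of_nonneg hsub fun p hp _ => ?_
          obtain ⟨hpn, hpp⟩ := Nat.mem_primesLE.mp hp
          have h1 : (1 : ℝ) ≤ Nat.log p n := by
            have : 1 ≤ Nat.log p n := Nat.log_pos hpp.one_lt hpn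
            exact_mod_cast this
          have h2 : 0 ≤ Real.log p := Real.log_natCast_nonneg p
          nlinarith
        linarith

/-- **Primes with no multiple in the range do not divide the lcm**: if `c·p < a` and
`n < (c+1)·p` then `p ∤ lcm(a,…,n)`.
[cite: CalegariDimitrovTang2024, §5 proof of Lemma 48: "The only primes p ≤ n not occurring in this count are those that admit an a ∈ ℕ such that ap < n−k and (a+1)p > n" (p. 43)] -/
theorem not_dvd_lcmIcc_of_gap {a n p c : ℕ} (hp : p.Prime) (ha : 1 ≤ a) (h1 : c * p < a)
    (h2 : n < (c + 1) * p) : ¬ p ∣ lcmIcc a n := by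
  intro hdvd
  -- `p ∣ lcm ⇒ v_p(lcm) ≥ 1 ⇒ some m ∈ [a,n] has v_p(m) ≥ 1`
  have hL0 : lcmIcc a n ≠ 0 := lcmIcc_ne_zero ha
  have hv : 1 ≤ (lcmIcc a n).factorization p := (hp.pow_dvd_iff_le_factorization hL0).mp (by simpa)
  unfold lcmIcc at hv
  rw [Finset.factorization_lcm (fun m hm => by
    have := (Finset.mem_Icc.mp hm).1; simp only [id_eq]; omega)] at hv
  -- a sup over a finset is `≥ 1` only if some member is
  obtain ⟨m, hm, hmv⟩ : ∃ m ∈ Finset.Icc a n, 1 ≤ (m : ℕ).factorization p := by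
    by_contra hcon
    push Not at hcon
    have : (Finset.Icc a n).sup (fun m => (id m).factorization p) ≤ 0 :=
      Finset.sup_le fun m hm => Nat.lt_one_iff.mp (hcon m hm) |>.le
    omega
  obtain ⟨hma, hmn⟩ := Finset.mem_Icc.mp hm
  have hm0 : m ≠ 0 := by omega
  have hpm : p ∣ m := by
    have := (hp.pow_dvd_iff_le_factorization hm0).mpr hmv
    simpa using this
  obtain ⟨d, rfl⟩ := hpm
  -- `c p < a ≤ p d ≤ n < (c+1) p` forces `c < d < c + 1`
  have hd1 : c < d := by
    by_contra h; push Not at h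
    have : p * d ≤ p * c := Nat.mul_le_mul_left p h
    linarith [mul_comm c p]
  have hd2 : d < c + 1 := by
    by_contra h; push Not at h
    have : p * (c + 1) ≤ p * d := Nat.mul_le_mul_left p h
    linarith [mul_comm (c + 1) p]
  omega


/-! ### The sieve: primes in the gaps `(n/(c+1), (n−k)/c)` -/

/-- For `c ≥ 1`, the primes `p ≤ n` with `n/(c+1) < p ≤ (n−k)/c − 1`. [folklore] -/
def gapPrimes (n k c : ℕ) : Finset ℕ :=
  (Nat.primesLE n).filter fun p => (n : ℝ) / (c + 1) < p ∧ (p : ℝ) ≤ ((n - k : ℕ) : ℝ) / c - 1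

/-- Gap primes do not divide `lcm(n−k,…,n)`. [folklore] -/
theorem not_dvd_of_mem_gapPrimes {n k c p : ℕ} (hc : 1 ≤ c) (hnk : 1 ≤ n - k)
    (hp : p ∈ gapPrimes n k c) : ¬ p ∣ lcmIcc (n - k) n := by
  unfold gapPrimes at hp
  rw [Finset.mem_filter, Nat.mem_primesLE] at hp
  obtain ⟨⟨_, hpp⟩, h1, h2⟩ := hp
  have hc0 : (0 : ℝ) < c := by exact_mod_cast hc
  refine not_dvd_lcmIcc_of_gap (c := c) hpp hnk ?_ ?_
  · -- `c p ≤ (n−k) − c < n − k`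
    have h3 : (c : ℝ) * p ≤ ((n - k : ℕ) : ℝ) - c := by
      have := mul_le_mul_of_nonneg_left h2 hc0.le
      rw [mul_sub, mul_one, mul_div_cancel₀ _ hc0.ne'] at this
      exact this
    have h4 : ((c * p : ℕ) : ℝ) < ((n - k : ℕ) : ℝ) := by push_cast; linarith
    exact_mod_cast h4
  · have h3 : (n : ℝ) < (c + 1) * p := by
      have hc1 : (0 : ℝ) < c + 1 := by positivity
      rw [div_lt_iff₀ hc1] at h1
      linarith
    exact_mod_cast h3

/-- Gap prime sets for different `c` are disjoint. [folklore] -/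
theorem disjoint_gapPrimes {n k c c' : ℕ} (hc : 1 ≤ c) (hcc' : c < c') :
    Disjoint (gapPrimes n k c) (gapPrimes n k c') := by
  rw [Finset.disjoint_left]
  intro p hp hp'
  unfold gapPrimes at hp hp'
  rw [Finset.mem_filter] at hp hp'
  obtain ⟨_, h1, _⟩ := hp
  obtain ⟨_, _, h2'⟩ := hp'
  -- `(n−k)/c' − 1 < n/(c+1)` since `c' ≥ c + 1` and `n − k ≤ n`
  have hc1 : (0 : ℝ) < c + 1 := by positivity
  have hc'0 : (0 : ℝ) < c' := by exact_mod_cast (show 0 < c' by omega)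
  have hcc : (c : ℝ) + 1 ≤ c' := by exact_mod_cast (show c + 1 ≤ c' by omega)
  have hnk : ((n - k : ℕ) : ℝ) ≤ n := by exact_mod_cast Nat.sub_le n k
  have hn0 : (0 : ℝ) ≤ ((n - k : ℕ) : ℝ) := by positivity
  have : ((n - k : ℕ) : ℝ) / c' ≤ (n : ℝ) / (c + 1) := by
    rw [div_le_div_iff₀ hc'0 hc1]
    nlinarith
  linarith

/-- `θ(y) − θ(x) ≤ Σ_{gap primes} log p` with `x = n/(c+1)`, `y = (n−k)/c − 1`. [folklore] -/
theorem theta_sub_theta_le_sum_gapPrimes (n k c : ℕ) (hc : 1 ≤ c) :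
    Chebyshev.theta (((n - k : ℕ) : ℝ) / c - 1) - Chebyshev.theta ((n : ℝ) / (c + 1)) ≤
      ∑ p ∈ gapPrimes n k c, Real.log p := by
  set x : ℝ := (n : ℝ) / (c + 1) with hx
  set y : ℝ := ((n - k : ℕ) : ℝ) / c - 1 with hy
  have hx0 : 0 ≤ x := by positivity
  rw [Chebyshev.theta_eq_sum_primesLE y, Chebyshev.theta_eq_sum_primesLE x]
  -- split the primes `≤ ⌊y⌋` at `⌊x⌋`
  rw [← Finset.sum_filter_add_sum_filter_not (Nat.primesLE ⌊y⌋₊) (fun p => p ≤ ⌊x⌋₊)]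
  have h1 : ∑ p ∈ (Nat.primesLE ⌊y⌋₊).filter (fun p => p ≤ ⌊x⌋₊), Real.log p ≤
      ∑ p ∈ Nat.primesLE ⌊x⌋₊, Real.log p := by
    refine Finset.sum_le_sum_of_subset_of_nonneg ?_ fun p _ _ => Real.log_natCast_nonneg p
    intro p hp
    rw [Finset.mem_filter, Nat.mem_primesLE] at hp
    exact Nat.mem_primesLE.mpr ⟨hp.2, hp.1.2⟩
  have h2 : ∑ p ∈ (Nat.primesLE ⌊y⌋₊).filter (fun p => ¬ p ≤ ⌊x⌋₊), Real.log p ≤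
      ∑ p ∈ gapPrimes n k c, Real.log p := by
    refine Finset.sum_le_sum_of_subset_of_nonneg ?_ fun p _ _ => Real.log_natCast_nonneg p
    intro p hp
    rw [Finset.mem_filter, Nat.mem_primesLE] at hp
    obtain ⟨⟨hpy, hpp⟩, hpx⟩ := hp
    push Not at hpx
    -- `y ≥ 0` here (else no prime `≤ ⌊y⌋₊ = 0`)
    have hy0 : 0 ≤ y := by
      by_contra hneg
      push Not at hneg
      rw [Nat.floor_of_nonpos hneg.le] at hpy
      exact absurd hpy (by have := hpp.two_le; omega)
    have hpy' : (p : ℝ) ≤ y := (Nat.le_floor_iff hy0).mp hpy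
    have hpx' : x < p := (Nat.floor_lt hx0).mp hpx
    unfold gapPrimes
    rw [Finset.mem_filter, Nat.mem_primesLE]
    refine ⟨⟨?_, hpp⟩, hpx', hpy'⟩
    -- `p ≤ y ≤ n`
    have hc0 : (1 : ℝ) ≤ c := by exact_mod_cast hc
    have hnk : ((n - k : ℕ) : ℝ) ≤ n := by exact_mod_cast Nat.sub_le n k
    have : y ≤ n := by
      rw [hy]
      have : ((n - k : ℕ) : ℝ) / c ≤ ((n - k : ℕ) : ℝ) := div_le_self (by positivity) hc0
      linarith
    exact_mod_cast hpy'.trans this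
  linarith

/-- **The sieve bound**: `θ_L ≤ θ(n) − Σ_{c=1}^{C} (θ((n−k)/c − 1) − θ(n/(c+1)))` for
`L = lcm(n−k, …, n)`, `n − k ≥ 1`, any `C`.
[cite: CalegariDimitrovTang2024, §5 proof of Lemma 48 (p. 43)] -/
theorem thetaOf_lcmIcc_le (n k C : ℕ) (hnk : 1 ≤ n - k) :
    thetaOf (lcmIcc (n - k) n) ≤ Chebyshev.theta n -
      ∑ c ∈ Finset.Icc 1 C, (Chebyshev.theta (((n - k : ℕ) : ℝ) / c - 1) -
        Chebyshev.theta ((n : ℝ) / (c + 1))) := by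
  set L := lcmIcc (n - k) n with hL
  have hsub : L.primeFactors ⊆ Nat.primesLE n := primeFactors_lcmIcc_subset hnk
  -- `θ(n) − θ_L = Σ_{p ≤ n, p ∤ L} log p`
  have hsplit : Chebyshev.theta n - thetaOf L = ∑ p ∈ Nat.primesLE n \ L.primeFactors, Real.log p := by
    rw [Chebyshev.theta_eq_sum_primesLE_log, thetaOf, ← Finset.sum_sdiff hsub]
    ring
  -- the gap primes form a disjoint family inside `primesLE n ∖ primeFactors L`
  have hdisj : ((Finset.Icc 1 C : Finset ℕ) : Set ℕ).PairwiseDisjoint (gapPrimes n k) := by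
    intro c hc c' hc' hne
    have hc1 : 1 ≤ c := (Finset.mem_Icc.mp hc).1
    have hc'1 : 1 ≤ c' := (Finset.mem_Icc.mp hc').1
    rcases Nat.lt_or_gt_of_ne hne with h | h
    · exact disjoint_gapPrimes hc1 h
    · exact (disjoint_gapPrimes hc'1 h).symm
  have hU : (Finset.Icc 1 C).biUnion (gapPrimes n k) ⊆ Nat.primesLE n \ L.primeFactors := by
    intro p hp
    rw [Finset.mem_biUnion] at hp
    obtain ⟨c, hc, hpc⟩ := hp
    have hc1 : 1 ≤ c := (Finset.mem_Icc.mp hc).1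
    rw [Finset.mem_sdiff]
    refine ⟨(Finset.mem_filter.mp hpc).1, fun hpL => ?_⟩
    exact not_dvd_of_mem_gapPrimes hc1 hnk hpc (Nat.dvd_of_mem_primeFactors hpL)
  have h1 : ∑ c ∈ Finset.Icc 1 C, (Chebyshev.theta (((n - k : ℕ) : ℝ) / c - 1) -
      Chebyshev.theta ((n : ℝ) / (c + 1))) ≤
      ∑ c ∈ Finset.Icc 1 C, ∑ p ∈ gapPrimes n k c, Real.log p :=
    Finset.sum_le_sum fun c hc => theta_sub_theta_le_sum_gapPrimes n k c (Finset.mem_Icc.mp hc).1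
  have h2 : ∑ c ∈ Finset.Icc 1 C, ∑ p ∈ gapPrimes n k c, Real.log p =
      ∑ p ∈ (Finset.Icc 1 C).biUnion (gapPrimes n k), Real.log p :=
    (Finset.sum_biUnion hdisj).symm
  have h3 : ∑ p ∈ (Finset.Icc 1 C).biUnion (gapPrimes n k), Real.log p ≤
      ∑ p ∈ Nat.primesLE n \ L.primeFactors, Real.log p :=
    Finset.sum_le_sum_of_subset_of_nonneg hU fun p _ _ => Real.log_natCast_nonneg p
  linarith


/-! ### The prime number theorem input: `θ(x) ∼ x` -/

open Filter Topology

/-- `θ(x) ≤ (1 + η) x` for large `x` (from `ψ(x) ≤ (1+η)x`, `θ ≤ ψ`). [folklore] -/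
theorem eventually_theta_le_mul {η : ℝ} (hη : 0 < η) :
    ∀ᶠ x : ℝ in atTop, Chebyshev.theta x ≤ (1 + η) * x :=
  (eventually_psi_le_mul hη).mono fun x hx => (Chebyshev.theta_le_psi x).trans hx

/-- `(1 − η) x ≤ θ(x)` for large `x` (from `(1 − η/2)x ≤ ψ(x)` and
`ψ(x) − θ(x) ≤ 2 √x log x = o(x)`). [folklore] -/
theorem eventually_mul_le_theta {η : ℝ} (hη : 0 < η) :
    ∀ᶠ x : ℝ in atTop, (1 - η) * x ≤ Chebyshev.theta x := by
  have h1 := eventually_mul_le_psi (half_pos hη)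
  have h2 : ∀ᶠ x : ℝ in atTop, Real.log x ≤ η / 4 * x ^ (1 / 2 : ℝ) := by
    have := (isLittleO_log_rpow_atTop (show (0 : ℝ) < 1 / 2 by norm_num)).bound
      (show 0 < η / 4 by positivity)
    filter_upwards [this, eventually_ge_atTop 1] with x hx hx1
    rw [Real.norm_of_nonneg (Real.log_nonneg hx1),
      Real.norm_of_nonneg (Real.rpow_nonneg (by linarith) _)] at hx
    exact hx
  filter_upwards [h1, h2, eventually_ge_atTop 1] with x hψ hlog hx1
  have h3 := Chebyshev.psi_sub_theta_le hx1
  have hsq : Real.sqrt x = x ^ (1 / 2 : ℝ) := Real.sqrt_eq_rpow x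
  have hxr : 0 ≤ x ^ (1 / 2 : ℝ) := Real.rpow_nonneg (by linarith) _
  have hxx : x ^ (1 / 2 : ℝ) * x ^ (1 / 2 : ℝ) = x := by
    rw [← Real.rpow_add (by linarith)]; norm_num
  have h4 : 2 * Real.sqrt x * Real.log x ≤ η / 2 * x := by
    rw [hsq]
    have := mul_le_mul_of_nonneg_left hlog hxr
    nlinarith
  linarith

/-- Telescoping: `Σ_{c=1}^{m} (1/(c+1) − 1/c) = 1/(m+1) − 1`. [folklore] -/
theorem sum_Icc_inv_succ_sub_inv (m : ℕ) :
    ∑ c ∈ Finset.Icc 1 m, (1 / ((c : ℝ) + 1) - 1 / (c : ℝ)) = 1 / ((m : ℝ) + 1) - 1 := by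
  induction m with
  | zero => simp
  | succ m ih =>
      rw [Finset.sum_Icc_succ_top (by omega), ih]
      push_cast
      ring

/-- `Σ_{c=1}^{m} 1/c = H_m`. [folklore] -/
theorem sum_Icc_inv_eq_harmonic (m : ℕ) :
    ∑ c ∈ Finset.Icc 1 m, (1 / (c : ℝ)) = (harmonic m : ℝ) := by
  rw [harmonic_eq_sum_Icc, Rat.cast_sum]
  refine Finset.sum_congr rfl fun c _ => ?_
  push_cast
  ring

/-- The bookkeeping inequality behind the error term of Lemma 48. [folklore] -/
theorem lemma48_errorBound {η ε n k q H Q : ℝ} (hη0 : 0 < η) (hn0 : 0 < n)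
    (hk0 : 0 ≤ k) (hq1 : 1 ≤ q) (hqQ : q ≤ Q) (hH0 : 0 ≤ H) (hHQ : H ≤ Q)
    (hηQ : η * Q = ε / 12) (hnQ : 12 * Q ≤ ε * n) :
    (1 + η) * n - ((1 - η) * ((n - k) * H - (q - 1)) - (1 + η) * (n * (H + 1 / q - 1))) ≤
      H * k + n / q + ε / 3 * n := by
  have hid : (1 + η) * n - ((1 - η) * ((n - k) * H - (q - 1)) - (1 + η) * (n * (H + 1 / q - 1))) =
      H * k + n / q +
        (η * ((n - k) * H) + (1 - η) * (q - 1) + η * (n * H) + η * (n / q)) := by ring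
  rw [hid]
  have hq0 : 0 < q := by linarith
  have h1q : n / q ≤ n := div_le_self hn0.le hq1
  have hηle : η ≤ ε / 12 := by
    have : η * 1 ≤ η * Q := mul_le_mul_of_nonneg_left (hq1.trans hqQ) hη0.le
    linarith
  have e1 : η * ((n - k) * H) ≤ η * (n * Q) := by
    refine mul_le_mul_of_nonneg_left ?_ hη0.le
    have : (n - k) * H ≤ n * H := by nlinarith
    nlinarith
  have e2 : η * (n * H) ≤ η * (n * Q) :=
    mul_le_mul_of_nonneg_left (mul_le_mul_of_nonneg_left hHQ hn0.le) hη0.le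
  have e3 : (1 - η) * (q - 1) ≤ ε / 12 * n := by
    have h4 : 0 ≤ η * (q - 1) := mul_nonneg hη0.le (by linarith)
    have h5 : (1 - η) * (q - 1) = (q - 1) - η * (q - 1) := by ring
    rw [h5]
    linarith
  have e4 : η * (n / q) ≤ ε / 12 * n :=
    (mul_le_mul_of_nonneg_left h1q hη0.le).trans (mul_le_mul_of_nonneg_right hηle hn0.le)
  have e5 : η * (n * Q) = ε / 12 * n := by
    rw [show η * (n * Q) = η * Q * n by ring, hηQ]
  linarith

/-- **CDT Lemma 48 (upper bound), uniformly in the range `k/n > 1/(Q+1)`**: for every `Q ≥ 1`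
and `ε > 0` there is `N₀` such that for all `n ≥ N₀` and `1 ≤ k < n` with `⌊n/k⌋ ≤ Q`,
`log lcm(n−k, …, n) ≤ H_{q−1}·k + n/q + ε n`, `q := ⌊n/k⌋ = ⌊1/γ⌋`, `γ = k/n`
(so `log L_{n,k} = (Σ_{h=1}^{⌊1/γ⌋−1} 1/h) k + ⌊1/γ⌋⁻¹ n + o(n)` from above, uniformly for
`γ` bounded below — the half of Lemma 48 (1)–(2) that bounds denominators).
[cite: CalegariDimitrovTang2024, §5 Lemma 48 (1)–(2) (pp. 43–44)] -/
theorem log_lcmIcc_le (Q : ℕ) (hQ : 1 ≤ Q) {ε : ℝ} (hε : 0 < ε) :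
    ∃ N₀ : ℕ, ∀ n k : ℕ, N₀ ≤ n → 1 ≤ k → k < n → n / k ≤ Q →
      Real.log (lcmIcc (n - k) n) ≤
        (harmonic (n / k - 1) : ℝ) * k + (n : ℝ) / (n / k : ℕ) + ε * n := by
  -- PNT thresholds
  obtain ⟨η, hη⟩ : ∃ η : ℝ, η = ε / (12 * Q) := ⟨_, rfl⟩
  have hQ0 : (0 : ℝ) < Q := by exact_mod_cast hQ
  have hη0 : 0 < η := by rw [hη]; positivity
  obtain ⟨X₁, hX₁⟩ := Filter.eventually_atTop.mp (eventually_mul_le_theta hη0)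
  obtain ⟨X₂, hX₂⟩ := Filter.eventually_atTop.mp (eventually_theta_le_mul hη0)
  obtain ⟨X₃, hX₃⟩ := Filter.eventually_atTop.mp (eventually_psi_le_mul (show 0 < ε / 6 by positivity))
  obtain ⟨X₄, hX₄⟩ := Filter.eventually_atTop.mp (eventually_mul_le_theta (show 0 < ε / 6 by positivity))
  set X : ℝ := max (max X₁ X₂) (max X₃ X₄) with hX
  refine ⟨max ⌈(Q : ℝ) * (|X| + 1)⌉₊ ⌈12 * Q / ε⌉₊, ?_⟩
  intro n k hn hk hkn hqQ
  obtain ⟨q, hq⟩ : ∃ q : ℕ, q = n / k := ⟨_, rfl⟩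
  rw [← hq] at hqQ
  have hn1 : ⌈(Q : ℝ) * (|X| + 1)⌉₊ ≤ n := le_of_max_le_left hn
  have hn2 : ⌈12 * Q / ε⌉₊ ≤ n := le_of_max_le_right hn
  have hnR1 : (Q : ℝ) * (|X| + 1) ≤ n := (Nat.le_ceil _).trans (by exact_mod_cast hn1)
  have hnR2 : 12 * Q / ε ≤ n := (Nat.le_ceil _).trans (by exact_mod_cast hn2)
  have hq1 : 1 ≤ q := hq ▸ (Nat.one_le_div_iff (by omega)).mpr hkn.le
  have hqQ' : (q : ℝ) ≤ Q := by exact_mod_cast hqQ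
  have hq0 : (0 : ℝ) < q := by exact_mod_cast hq1
  have hk0 : (0 : ℝ) < k := by exact_mod_cast hk
  have hn0 : (0 : ℝ) < n := by exact_mod_cast (show 0 < n by omega)
  have hnk1 : 1 ≤ n - k := by omega
  have hnkR : ((n - k : ℕ) : ℝ) = n - k := by push_cast [Nat.cast_sub hkn.le]; ring
  -- `k ≤ n/q`
  have hkq : (k : ℝ) * q ≤ n := by
    have : q * k ≤ n := hq ▸ Nat.div_mul_le_self n k
    rw [mul_comm]; exact_mod_cast this
  -- all evaluation points are `≥ X`: they are `≥ n/Q − 1`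
  have hXle : |X| + 1 ≤ (n : ℝ) / Q := by
    rw [le_div_iff₀ hQ0]; linarith
  have hXabs : X ≤ |X| := le_abs_self X
  have hbig : ∀ t : ℝ, (n : ℝ) / Q - 1 ≤ t → X ≤ t := fun t ht => by linarith
  have hX1 : ∀ t, X ≤ t → (1 - η) * t ≤ Chebyshev.theta t := fun t ht =>
    hX₁ t ((le_max_left _ _).trans ((le_max_left _ _).trans ht) |>.trans' le_rfl)
  have hX2 : ∀ t, X ≤ t → Chebyshev.theta t ≤ (1 + η) * t := fun t ht =>
    hX₂ t (le_trans (le_trans (le_max_right X₁ X₂) (le_max_left _ _)) ht)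
  have hX3 : Chebyshev.psi n ≤ (1 + ε / 6) * n :=
    hX₃ n (le_trans (le_trans (le_max_left X₃ X₄) (le_max_right _ _)) (hbig n (by
      have : (n : ℝ) / Q ≤ n := div_le_self hn0.le (by exact_mod_cast hQ); linarith)))
  have hX4 : (1 - ε / 6) * n ≤ Chebyshev.theta n :=
    hX₄ n (le_trans (le_trans (le_max_right X₃ X₄) (le_max_right _ _)) (hbig n (by
      have : (n : ℝ) / Q ≤ n := div_le_self hn0.le (by exact_mod_cast hQ); linarith)))
  -- Step 1 + Step 2
  have h12 : Real.log (lcmIcc (n - k) n) ≤ Chebyshev.theta n -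
      ∑ c ∈ Finset.Icc 1 (q - 1), (Chebyshev.theta (((n - k : ℕ) : ℝ) / c - 1) -
        Chebyshev.theta ((n : ℝ) / (c + 1))) + (Chebyshev.psi n - Chebyshev.theta n) := by
    have := log_lcmIcc_le_thetaOf_add (n := n) hnk1
    have := thetaOf_lcmIcc_le n k (q - 1) hnk1
    linarith
  -- bound the gap sum from below
  have hgap : ∀ c ∈ Finset.Icc 1 (q - 1),
      ((1 - η) * (((n - k : ℕ) : ℝ) / c - 1) - (1 + η) * ((n : ℝ) / (c + 1))) ≤
      Chebyshev.theta (((n - k : ℕ) : ℝ) / c - 1) - Chebyshev.theta ((n : ℝ) / (c + 1)) := by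
    intro c hc
    obtain ⟨hc1, hcq⟩ := Finset.mem_Icc.mp hc
    have hc0 : (0 : ℝ) < c := by exact_mod_cast hc1
    have hcq' : (c : ℝ) ≤ q - 1 := by
      have : c + 1 ≤ q := by omega
      have : ((c + 1 : ℕ) : ℝ) ≤ q := by exact_mod_cast this
      push_cast at this; linarith
    -- `y_c ≥ n/q − 1 ≥ n/Q − 1`
    have hy : (n : ℝ) / Q - 1 ≤ ((n - k : ℕ) : ℝ) / c - 1 := by
      rw [hnkR]
      have h1 : (n : ℝ) / Q ≤ (n : ℝ) / q := div_le_div_of_nonneg_left hn0.le hq0 hqQ'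
      have h2 : (n : ℝ) / q ≤ (n - k) / c := by
        rw [div_le_div_iff₀ hq0 hc0]
        nlinarith
      linarith
    have hx : (n : ℝ) / Q - 1 ≤ (n : ℝ) / (c + 1) := by
      have hc1' : (0 : ℝ) < c + 1 := by positivity
      have h1 : (n : ℝ) / Q ≤ (n : ℝ) / q := div_le_div_of_nonneg_left hn0.le hq0 hqQ'
      have h2 : (n : ℝ) / q ≤ (n : ℝ) / (c + 1) :=
        div_le_div_of_nonneg_left hn0.le hc1' (by linarith)
      linarith
    have := hX1 _ (hbig _ hy)
    have := hX2 _ (hbig _ hx)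
    linarith
  have hsum := Finset.sum_le_sum hgap
  -- evaluate the main sum: `S₁ = Σ 1/c = H_{q−1}`, `S₂ = Σ 1/(c+1) = H_{q−1} + 1/q − 1`
  obtain ⟨H, hHdef⟩ : ∃ H : ℝ, H = (harmonic (q - 1) : ℝ) := ⟨_, rfl⟩
  have hS1 : ∑ c ∈ Finset.Icc 1 (q - 1), (1 / (c : ℝ)) = H := by
    rw [hHdef]; exact sum_Icc_inv_eq_harmonic (q - 1)
  have hq1R : ((q - 1 : ℕ) : ℝ) = q - 1 := by rw [Nat.cast_sub hq1]; push_cast; ring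
  have hS2 : ∑ c ∈ Finset.Icc 1 (q - 1), (1 / ((c : ℝ) + 1)) = H + 1 / q - 1 := by
    have htel := sum_Icc_inv_succ_sub_inv (q - 1)
    rw [Finset.sum_sub_distrib, hS1, hq1R, sub_add_cancel] at htel
    linarith
  have hmain : ∑ c ∈ Finset.Icc 1 (q - 1),
      ((1 - η) * (((n - k : ℕ) : ℝ) / c - 1) - (1 + η) * ((n : ℝ) / (c + 1))) =
      (1 - η) * ((n - k) * H - (q - 1)) - (1 + η) * (n * (H + 1 / q - 1)) := by
    have hcard : ((Finset.Icc 1 (q - 1)).card : ℝ) = q - 1 := by simp [hq1R]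
    have e1 : ∀ c ∈ Finset.Icc 1 (q - 1),
        ((1 - η) * (((n - k : ℕ) : ℝ) / c - 1) - (1 + η) * ((n : ℝ) / (c + 1))) =
        (1 - η) * (n - k) * (1 / (c : ℝ)) - (1 - η) - (1 + η) * n * (1 / ((c : ℝ) + 1)) := by
      intro c _
      rw [hnkR]; ring
    rw [Finset.sum_congr rfl e1, Finset.sum_sub_distrib, Finset.sum_sub_distrib,
      ← Finset.mul_sum, ← Finset.mul_sum, hS1, hS2, Finset.sum_const, nsmul_eq_mul, hcard]
    ring
  have hH0 : 0 ≤ H := by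
    rw [← hS1]; exact Finset.sum_nonneg fun c _ => by positivity
  have hHq : H ≤ Q := by
    rw [← hS1]
    calc ∑ c ∈ Finset.Icc 1 (q - 1), (1 / (c : ℝ)) ≤ ∑ c ∈ Finset.Icc 1 (q - 1), (1 : ℝ) := by
          refine Finset.sum_le_sum fun c hc => ?_
          have : (1 : ℝ) ≤ c := by exact_mod_cast (Finset.mem_Icc.mp hc).1
          exact (div_le_one (by linarith)).mpr this
      _ = q - 1 := by simp [hq1R]
      _ ≤ Q := by linarith
  -- assemble
  have hkn' : (k : ℝ) ≤ n := by exact_mod_cast hkn.le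
  have hnq : (n : ℝ) / Q ≤ n := div_le_self hn0.le (by exact_mod_cast hQ)
  have hA : Chebyshev.theta n ≤ (1 + η) * n := hX2 n (hbig n (by linarith))
  have hB : Chebyshev.psi n - Chebyshev.theta n ≤ ε / 3 * n := by linarith
  have hηQ : η * Q = ε / 12 := by rw [hη]; field_simp
  have hq1' : (1 : ℝ) ≤ q := by exact_mod_cast hq1
  have hnQ : 12 * (Q : ℝ) ≤ ε * n := by
    have := hnR2; rw [div_le_iff₀ hε] at this; linarith
  have herr := lemma48_errorBound (k := (k : ℝ)) hη0 hn0 hk0.le hq1' hqQ' hH0 hHq hηQ hnQ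
  calc Real.log (lcmIcc (n - k) n) ≤ _ := h12
    _ ≤ (1 + η) * n - ∑ c ∈ Finset.Icc 1 (q - 1),
          ((1 - η) * (((n - k : ℕ) : ℝ) / c - 1) - (1 + η) * ((n : ℝ) / (c + 1))) +
          ε / 3 * n := by linarith
    _ = (1 + η) * n - ((1 - η) * ((n - k) * H - (q - 1)) - (1 + η) * (n * (H + 1 / q - 1))) +
          ε / 3 * n := by rw [hmain]
    _ ≤ H * k + n / q + ε * n := by linarith
    _ = (harmonic (n / k - 1) : ℝ) * k + (n : ℝ) / (n / k : ℕ) + ε * n := by rw [hHdef, hq]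


/-! ### Lemma 48 (2): the full range of `k` -/

/-- Monotonicity in the range: `lcm(a,…,b) ∣ lcm(a',…,b)` for `a' ≤ a`. [folklore] -/
theorem lcmIcc_dvd_lcmIcc {a a' b : ℕ} (h : a' ≤ a) : lcmIcc a b ∣ lcmIcc a' b :=
  Finset.lcm_mono (Finset.Icc_subset_Icc h le_rfl)

/-- `log lcm(n−k,…,n) ≤ log lcm(n−k',…,n)` for `k ≤ k' < n`. [folklore] -/
theorem log_lcmIcc_mono {n k k' : ℕ} (hkk : k ≤ k') (hk'n : k' < n) :
    Real.log (lcmIcc (n - k) n) ≤ Real.log (lcmIcc (n - k') n) := by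
  have h0 : lcmIcc (n - k') n ≠ 0 := lcmIcc_ne_zero (by omega)
  have h0' : lcmIcc (n - k) n ≠ 0 := lcmIcc_ne_zero (by omega)
  have hd : lcmIcc (n - k) n ∣ lcmIcc (n - k') n := lcmIcc_dvd_lcmIcc (by omega)
  have hle : lcmIcc (n - k) n ≤ lcmIcc (n - k') n := Nat.le_of_dvd (Nat.pos_of_ne_zero h0) hd
  exact Real.log_le_log (by exact_mod_cast Nat.pos_of_ne_zero h0') (by exact_mod_cast hle)

/-- `lcm(n, …, n) = n`. [folklore] -/
theorem lcmIcc_self (n : ℕ) : lcmIcc n n = n := by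
  unfold lcmIcc
  rw [Finset.Icc_self, Finset.lcm_singleton]
  simp

/-- `lcm(0, …, n) = 0` (the degenerate case `k = n`). [folklore] -/
theorem lcmIcc_zero (n : ℕ) : lcmIcc 0 n = 0 := by
  unfold lcmIcc
  rw [Finset.lcm_eq_zero_iff]
  exact ⟨0, Finset.mem_Icc.mpr ⟨le_rfl, Nat.zero_le n⟩, rfl⟩

/-- **CDT Lemma 48 (2)**: for every `ε > 0` there is `N₀` such that for all `n ≥ N₀` and all
`0 ≤ k ≤ n`, `log lcm(n−k, …, n) ≤ (Σ_{h=1}^{⌊1/γ⌋−1} 1/h) k + ⌊1/γ⌋⁻¹ n + ε n`, `γ = k/n`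
(with `⌊1/γ⌋ = ⌊n/k⌋`; for `k = 0` both main terms vanish and the claim is `log n ≤ ε n`).
As in the printed proof, small `k < n/(Q+1)` are handled by monotonicity in `k` and the bound at
`k' ≈ n/(Q+1)`, whose main term `((1 + log Q)/(Q+1) + 1/Q) n` is `≤ ε n/2` for `Q` large.
[cite: CalegariDimitrovTang2024, §5 Lemma 48 (2) (pp. 43–44)] -/
theorem log_lcmIcc_le_uniform {ε : ℝ} (hε : 0 < ε) :
    ∃ N₀ : ℕ, ∀ n k : ℕ, N₀ ≤ n → k ≤ n →
      Real.log (lcmIcc (n - k) n) ≤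
        (harmonic (n / k - 1) : ℝ) * k + (n : ℝ) / (n / k : ℕ) + ε * n := by
  -- choose `Q` with `(1 + log Q)/Q + 1/Q ≤ ε/4`-ish: `log x ≤ (ε/16) x` for `x ≥ X`
  obtain ⟨X, hX⟩ := Filter.eventually_atTop.mp
    ((Real.isLittleO_log_id_atTop.bound (show (0:ℝ) < ε / 16 by positivity)).and
      (Filter.eventually_ge_atTop (1 : ℝ)))
  set Q : ℕ := max 2 ⌈max X (16 / ε)⌉₊ with hQdef
  have hQ2 : 2 ≤ Q := le_max_left _ _
  have hQ1 : 1 ≤ Q := by omega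
  have hQR : max X (16 / ε) ≤ Q := (Nat.le_ceil _).trans (by exact_mod_cast le_max_right 2 _)
  have hQX : X ≤ Q := (le_max_left _ _).trans hQR
  have hQε : 16 / ε ≤ Q := (le_max_right _ _).trans hQR
  have hQ0 : (0 : ℝ) < Q := by exact_mod_cast (show 0 < Q by omega)
  have hlogQ : Real.log Q ≤ ε / 16 * Q := by
    have := (hX Q hQX).1
    rw [Real.norm_of_nonneg (Real.log_nonneg (hX Q hQX).2), id, Real.norm_of_nonneg hQ0.le] at this
    exact this
  have h1Q : 1 / (Q : ℝ) ≤ ε / 16 := by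
    rw [div_le_iff₀ hQ0]; rw [div_le_iff₀ hε] at hQε; linarith
  -- the uniform bound for `⌊n/k⌋ ≤ Q` with `ε/2`
  obtain ⟨N₁, hN₁⟩ := log_lcmIcc_le Q hQ1 (half_pos hε)
  -- `log n ≤ ε n` and `1 + log Q ≤ ε n / 4` for large `n`
  obtain ⟨X₂, hX₂⟩ := Filter.eventually_atTop.mp
    ((Real.isLittleO_log_id_atTop.bound hε).and (Filter.eventually_ge_atTop (1 : ℝ)))
  refine ⟨max (max N₁ (Q * (Q + 1) + 3)) (max ⌈X₂⌉₊ ⌈4 * (1 + Real.log Q) / ε⌉₊), ?_⟩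
  intro n k hn hkn
  have hn1 : N₁ ≤ n := le_trans (le_max_left _ _) (le_of_max_le_left hn)
  have hn2 : Q * (Q + 1) + 3 ≤ n := le_trans (le_max_right _ _) (le_of_max_le_left hn)
  have hn3 : ⌈X₂⌉₊ ≤ n := le_trans (le_max_left _ _) (le_of_max_le_right hn)
  have hn4 : ⌈4 * (1 + Real.log Q) / ε⌉₊ ≤ n := le_trans (le_max_right _ _) (le_of_max_le_right hn)
  have hn0 : (0 : ℝ) < n := by exact_mod_cast (show 0 < n by omega)
  have hnX₂ : X₂ ≤ n := (Nat.le_ceil _).trans (by exact_mod_cast hn3)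
  have hn4R : 4 * (1 + Real.log Q) / ε ≤ n := (Nat.le_ceil _).trans (by exact_mod_cast hn4)
  -- degenerate cases `k = 0`, `k = n`
  rcases Nat.eq_zero_or_pos k with rfl | hk
  · simp only [Nat.sub_zero, Nat.div_zero, CharP.cast_eq_zero, mul_zero, zero_add, div_zero]
    rw [lcmIcc_self]
    have := (hX₂ n hnX₂).1
    rw [Real.norm_of_nonneg (Real.log_nonneg (hX₂ n hnX₂).2), id, Real.norm_of_nonneg hn0.le] at this
    exact this
  rcases eq_or_lt_of_le hkn with rfl | hkn'
  · rw [Nat.sub_self, lcmIcc_zero, Nat.cast_zero, Real.log_zero]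
    have : 0 ≤ (harmonic (k / k - 1) : ℝ) * k := by
      rw [Nat.div_self hk]; simp
    have : 0 ≤ (k : ℝ) / (k / k : ℕ) := by positivity
    nlinarith
  -- main cases
  have hRHS0 : 0 ≤ (harmonic (n / k - 1) : ℝ) * k + (n : ℝ) / (n / k : ℕ) := by
    have : 0 ≤ (harmonic (n / k - 1) : ℝ) := by
      rw [← sum_Icc_inv_eq_harmonic]; exact Finset.sum_nonneg fun c _ => by positivity
    positivity
  by_cases hq : n / k ≤ Q
  · -- the uniform regime
    have := hN₁ n k hn1 hk hkn' hq
    nlinarith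
  · -- small `k`: compare with `k' = n/(Q+1) + 1`
    push Not at hq
    set k' : ℕ := n / (Q + 1) + 1 with hk'
    have hk'1 : 1 ≤ k' := Nat.succ_pos _
    have hQ1' : 0 < Q + 1 := by omega
    -- `k ≤ n/(Q+1) < k'`
    have hkk' : k ≤ k' := by
      have h1 : Q + 1 ≤ n / k := hq
      have h2 : (Q + 1) * k ≤ n := (Nat.le_div_iff_mul_le hk).mp h1
      have h3 : k ≤ n / (Q + 1) := (Nat.le_div_iff_mul_le hQ1').mpr (by linarith [mul_comm (Q+1) k])
      omega
    -- `k' < n`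
    have hk'n : k' < n := by
      have h5 : n / (Q + 1) ≤ n / 2 := Nat.div_le_div_left (by omega) (by omega)
      have h6 : n / 2 < n - 1 := by omega
      rw [hk']; omega
    -- `n / k' ≤ Q` since `n < (Q+1) k'`
    have hq'Q : n / k' ≤ Q := by
      have h1 : n < (Q + 1) * k' := by
        have := Nat.lt_div_mul_add hQ1' (a := n)
        rw [hk']; linarith [mul_comm (n / (Q + 1)) (Q + 1), mul_add (Q + 1) (n / (Q + 1)) 1]
      have h2 : n / k' < Q + 1 := (Nat.div_lt_iff_lt_mul (by omega)).mpr (by linarith [mul_comm (Q+1) k'])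
      omega
    -- `Q ≤ n / k'` since `Q k' ≤ n` (using `n ≥ Q (Q+1)`)
    have hQq' : Q ≤ n / k' := by
      refine (Nat.le_div_iff_mul_le (by omega)).mpr ?_
      have h1 : Q ≤ n / (Q + 1) :=
        (Nat.le_div_iff_mul_le hQ1').mpr (le_trans (Nat.le_add_right _ 3) hn2)
      have h2 : n / (Q + 1) * (Q + 1) ≤ n := Nat.div_mul_le_self n (Q + 1)
      calc Q * k' = Q * (n / (Q + 1)) + Q := by rw [hk', Nat.mul_add, Nat.mul_one]
        _ ≤ Q * (n / (Q + 1)) + n / (Q + 1) := Nat.add_le_add_left h1 _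
        _ = n / (Q + 1) * (Q + 1) := by ring
        _ ≤ n := h2
    have hmono := log_lcmIcc_mono hkk' hk'n
    have hbd := hN₁ n k' hn1 hk'1 hk'n hq'Q
    -- bound the main term at `k'`
    set q' : ℕ := n / k' with hq'def
    have hq'1 : 1 ≤ q' := le_trans hQ1 hQq'
    have hq'0 : (0 : ℝ) < q' := by exact_mod_cast hq'1
    have hH : (harmonic (q' - 1) : ℝ) ≤ 1 + Real.log Q := by
      have h2 : (harmonic (q' - 1) : ℝ) ≤ (harmonic Q : ℝ) := by
        rw [← sum_Icc_inv_eq_harmonic, ← sum_Icc_inv_eq_harmonic]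
        exact Finset.sum_le_sum_of_subset_of_nonneg (Finset.Icc_subset_Icc le_rfl (by omega))
          fun c _ _ => by positivity
      exact h2.trans (harmonic_le_one_add_log Q)
    have hk'R : (k' : ℝ) ≤ n / (Q + 1) + 1 := by
      rw [hk']; push_cast
      have : ((n / (Q + 1) : ℕ) : ℝ) ≤ (n : ℝ) / (Q + 1) := by
        have := Nat.cast_div_le (m := n) (n := Q + 1) (α := ℝ)
        push_cast at this; exact this
      linarith
    have hnq' : (n : ℝ) / q' ≤ n / Q :=
      div_le_div_of_nonneg_left hn0.le hQ0 (by exact_mod_cast hQq')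
    have hlogQ0 : 0 ≤ Real.log Q := Real.log_nonneg (by exact_mod_cast hQ1)
    have hH0 : 0 ≤ (harmonic (q' - 1) : ℝ) := by
      rw [← sum_Icc_inv_eq_harmonic]; exact Finset.sum_nonneg fun c _ => by positivity
    -- `H k' + n/q' ≤ (1 + log Q)(n/(Q+1) + 1) + n/Q ≤ ε n / 2`
    have hQ1R : (0 : ℝ) < Q + 1 := by positivity
    have e1 : (harmonic (q' - 1) : ℝ) * k' ≤ (1 + Real.log Q) * (n / (Q + 1) + 1) := by
      have hk'0 : (0 : ℝ) ≤ k' := by positivity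
      calc (harmonic (q' - 1) : ℝ) * k' ≤ (1 + Real.log Q) * k' :=
            mul_le_mul_of_nonneg_right hH hk'0
        _ ≤ (1 + Real.log Q) * (n / (Q + 1) + 1) :=
            mul_le_mul_of_nonneg_left hk'R (by linarith)
    have e2 : (1 + Real.log Q) * ((n : ℝ) / (Q + 1)) ≤ ε / 8 * n := by
      -- `(1 + log Q)/(Q+1) ≤ 1/Q + log Q / Q ≤ ε/16 + ε/16`
      have h1 : (1 + Real.log Q) / (Q + 1) ≤ (1 + Real.log Q) / Q :=
        div_le_div_of_nonneg_left (by linarith) hQ0 (by linarith)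
      have h2 : (1 + Real.log Q) / Q ≤ ε / 8 := by
        rw [div_le_iff₀ hQ0]
        have : (1 : ℝ) ≤ ε / 16 * Q := by
          rw [div_le_iff₀ hQ0] at h1Q; linarith
        linarith
      have h3 : (1 + Real.log Q) * ((n : ℝ) / (Q + 1)) = (1 + Real.log Q) / (Q + 1) * n := by ring
      rw [h3]
      exact mul_le_mul_of_nonneg_right (h1.trans h2) hn0.le
    have e3 : (1 + Real.log Q) ≤ ε / 4 * n := by
      rw [div_le_iff₀ hε] at hn4R; linarith
    have e4 : (n : ℝ) / Q ≤ ε / 16 * n := by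
      rw [div_eq_mul_one_div]
      calc (n : ℝ) * (1 / Q) ≤ n * (ε / 16) := mul_le_mul_of_nonneg_left h1Q hn0.le
        _ = ε / 16 * n := by ring
    calc Real.log (lcmIcc (n - k) n) ≤ Real.log (lcmIcc (n - k') n) := hmono
      _ ≤ (harmonic (q' - 1) : ℝ) * k' + n / q' + ε / 2 * n := hbd
      _ ≤ ε * n := by nlinarith
      _ ≤ (harmonic (n / k - 1) : ℝ) * k + (n : ℝ) / (n / k : ℕ) + ε * n := by linarith


/-! ### Lemma 48 (1): the matching lower bound -/

/-- `θ_L ≤ log L`: every prime factor divides at least once. [folklore] -/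
theorem thetaOf_le_log (L : ℕ) : thetaOf L ≤ Real.log L := by
  rw [thetaOf, Real.log_nat_eq_sum_factorization L, Finsupp.sum]
  refine Finset.sum_le_sum fun p hp => ?_
  have h1 : 1 ≤ L.factorization p := by
    have := Nat.support_factorization L ▸ hp
    exact Nat.pos_of_ne_zero (Finsupp.mem_support_iff.mp this)
  have h1' : (1 : ℝ) ≤ L.factorization p := by exact_mod_cast h1
  have h2 : 0 ≤ Real.log p := Real.log_natCast_nonneg p
  nlinarith

/-- **A prime `p ≤ n` not dividing `lcm(n−k,…,n)` lies in a gap**: there is `1 ≤ c ≤ ⌊n/k⌋ − 1`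
with `c p < n − k` and `n < (c+1) p`.
[cite: CalegariDimitrovTang2024, §5 proof of Lemma 48 (p. 43)] -/
theorem exists_gap_of_not_dvd {n k p : ℕ} (hp : p.Prime) (hk : 1 ≤ k) (hnk : 1 ≤ n - k)
    (hpn : p ≤ n) (hndvd : ¬ p ∣ lcmIcc (n - k) n) :
    ∃ c, 1 ≤ c ∧ c ≤ n / k - 1 ∧ c * p < n - k ∧ n < (c + 1) * p := by
  -- `c := ⌊(n − k − 1)/p⌋`, the largest `c` with `c p ≤ n − k − 1`
  set c := (n - k - 1) / p with hc
  have hp0 : 0 < p := hp.pos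
  have h1 : c * p ≤ n - k - 1 := Nat.div_mul_le_self _ _
  have h2 : n - k - 1 < (c + 1) * p := by
    have := Nat.lt_div_mul_add hp0 (a := n - k - 1)
    rw [hc]; linarith [mul_comm ((n - k - 1) / p) p, add_mul ((n-k-1)/p) 1 p, one_mul p]
  -- `(c+1) p ∈ [n−k, n]` would give `p ∣ lcm`; hence `(c+1) p > n`
  have h3 : n < (c + 1) * p := by
    by_contra hle
    push Not at hle
    apply hndvd
    have hmem : (c + 1) * p ∈ Finset.Icc (n - k) n := Finset.mem_Icc.mpr ⟨by omega, hle⟩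
    exact (Dvd.intro_left _ rfl).trans (dvd_lcmIcc hmem)
  have hc1 : 1 ≤ c := by
    by_contra h0
    push Not at h0
    have : c = 0 := Nat.lt_one_iff.mp h0
    rw [this, zero_add, one_mul] at h3
    omega
  refine ⟨c, hc1, ?_, by omega, h3⟩
  -- `k (c+1) < n`, so `c + 1 ≤ n / k`
  have h4 : k * (c + 1) < n := by
    -- from `c p < n − k` and `n < (c+1) p`: `n c < (n − k)(c + 1)` i.e. `k (c+1) < n − ... `
    have h5 : c * p < n - k := by omega
    -- multiply: `n * c < (c+1) p c ≤ ...` — work in ℕ via `nlinarith`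
    by_contra hge
    push Not at hge
    -- `n ≤ k (c+1)` ⇒ `n c ≤ ...`; combine `c p ≤ n − k − 1` and `n + 1 ≤ (c+1) p`
    have e1 : (c + 1) * (c * p) ≤ (c + 1) * (n - k - 1) := Nat.mul_le_mul_left _ h1
    have e2 : c * (n + 1) ≤ c * ((c + 1) * p) := Nat.mul_le_mul_left _ h3
    have hkn : k ≤ n - 1 := by omega
    -- `(c+1)(n−k−1) = (c+1) n − (c+1)(k+1)` and `c(n+1) ≤ (c+1) c p ≤ (c+1)(n−k−1)`
    have e3 : c * (n + 1) ≤ (c + 1) * (n - k - 1) := by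
      calc c * (n + 1) ≤ c * ((c + 1) * p) := e2
        _ = (c + 1) * (c * p) := by ring
        _ ≤ (c + 1) * (n - k - 1) := e1
    -- now everything is linear in the atoms `c*n`, `c*k`: expand
    have e4 : c * (n + 1) + (c + 1) * (k + 1) ≤ (c + 1) * n := by
      have : (c + 1) * (n - k - 1) + (c + 1) * (k + 1) = (c + 1) * n := by
        rw [← Nat.mul_add]; congr 1; omega
      omega
    have e5 : (c + 1) * n ≤ (c + 1) * (k * (c + 1)) := Nat.mul_le_mul_left _ hge
    nlinarith
  have h6 : c + 1 ≤ n / k := (Nat.le_div_iff_mul_le hk).mpr (by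
    rw [mul_comm]; exact h4.le)
  omega

/-- Union bound for sums of a nonnegative function over a `biUnion`. [folklore] -/
theorem sum_biUnion_le_sum {ι M : Type*} [DecidableEq M] (s : Finset ι) (t : ι → Finset M)
    (f : M → ℝ) (hf : ∀ x, 0 ≤ f x) :
    ∑ x ∈ s.biUnion t, f x ≤ ∑ a ∈ s, ∑ x ∈ t a, f x := by
  classical
  induction s using Finset.induction_on with
  | empty => simp
  | insert a s has ih =>
      rw [Finset.biUnion_insert, Finset.sum_insert has]
      have h1 := Finset.sum_union_inter (s₁ := t a) (s₂ := s.biUnion t) (f := f)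
      have h2 : 0 ≤ ∑ x ∈ t a ∩ s.biUnion t, f x := Finset.sum_nonneg fun x _ => hf x
      linarith

/-- **The reverse sieve bound**: `θ(n) − Σ_{c=1}^{⌊n/k⌋−1} (θ((n−k)/c) − θ(n/(c+1))) ≤ θ_L`.
[cite: CalegariDimitrovTang2024, §5 proof of Lemma 48 (p. 43)] -/
theorem theta_sub_le_thetaOf_lcmIcc (n k : ℕ) (hk : 1 ≤ k) (hnk : 1 ≤ n - k) :
    Chebyshev.theta n - ∑ c ∈ Finset.Icc 1 (n / k - 1),
      (Chebyshev.theta (((n - k : ℕ) : ℝ) / c) - Chebyshev.theta ((n : ℝ) / (c + 1))) ≤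
      thetaOf (lcmIcc (n - k) n) := by
  set L := lcmIcc (n - k) n with hL
  have hsub : L.primeFactors ⊆ Nat.primesLE n := primeFactors_lcmIcc_subset hnk
  have hsplit : Chebyshev.theta n - thetaOf L =
      ∑ p ∈ Nat.primesLE n \ L.primeFactors, Real.log p := by
    rw [Chebyshev.theta_eq_sum_primesLE_log, thetaOf, ← Finset.sum_sdiff hsub]
    ring
  -- each non-divisor lies in some gap `(n/(c+1), (n−k)/c)`, `1 ≤ c ≤ q − 1`
  set G : ℕ → Finset ℕ := fun c =>
    (Nat.primesLE n).filter fun p => (n : ℝ) / (c + 1) < p ∧ (p : ℝ) ≤ ((n - k : ℕ) : ℝ) / c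
  have hcover : Nat.primesLE n \ L.primeFactors ⊆ (Finset.Icc 1 (n / k - 1)).biUnion G := by
    intro p hp
    rw [Finset.mem_sdiff, Nat.mem_primesLE] at hp
    obtain ⟨⟨hpn, hpp⟩, hpL⟩ := hp
    have hL0 : L ≠ 0 := lcmIcc_ne_zero hnk
    have hndvd : ¬ p ∣ L := fun h => hpL (Nat.mem_primeFactors.mpr ⟨hpp, h, hL0⟩)
    obtain ⟨c, hc1, hcq, h1, h2⟩ := exists_gap_of_not_dvd hpp hk hnk hpn hndvd
    rw [Finset.mem_biUnion]
    refine ⟨c, Finset.mem_Icc.mpr ⟨hc1, hcq⟩, ?_⟩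
    simp only [G, Finset.mem_filter, Nat.mem_primesLE]
    have hc0 : (0 : ℝ) < c := by exact_mod_cast hc1
    refine ⟨⟨hpn, hpp⟩, ?_, ?_⟩
    · rw [div_lt_iff₀ (by positivity)]
      have : ((n : ℕ) : ℝ) < (((c + 1) * p : ℕ) : ℝ) := by exact_mod_cast h2
      push_cast at this; linarith
    · rw [le_div_iff₀ hc0]
      have : ((c * p : ℕ) : ℝ) ≤ ((n - k : ℕ) : ℝ) := by exact_mod_cast h1.le
      push_cast at this; linarith
  -- `Σ_{G c} log p ≤ θ((n−k)/c) − θ(n/(c+1))`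
  have hG : ∀ c ∈ Finset.Icc 1 (n / k - 1), ∑ p ∈ G c, Real.log p ≤
      Chebyshev.theta (((n - k : ℕ) : ℝ) / c) - Chebyshev.theta ((n : ℝ) / (c + 1)) := by
    intro c hc
    set x : ℝ := (n : ℝ) / (c + 1) with hx
    set y : ℝ := ((n - k : ℕ) : ℝ) / c with hy
    have hx0 : 0 ≤ x := by positivity
    have hy0 : 0 ≤ y := by positivity
    rw [Chebyshev.theta_eq_sum_primesLE y, Chebyshev.theta_eq_sum_primesLE x]
    -- primes `≤ ⌊x⌋` are among primes `≤ ⌊y⌋` or the bound is trivial; write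
    -- `Σ_{primesLE ⌊y⌋} = Σ_{p ≤ ⌊x⌋} + Σ_{p > ⌊x⌋}` and compare
    rw [← Finset.sum_filter_add_sum_filter_not (Nat.primesLE ⌊y⌋₊) (fun p => p ≤ ⌊x⌋₊)]
    -- `G c ⊆ {p ∈ primesLE ⌊y⌋ : p > ⌊x⌋}` and conversely, so the sums agree
    have hGeq : G c = (Nat.primesLE ⌊y⌋₊).filter (fun p => ¬ p ≤ ⌊x⌋₊) := by
      ext p
      simp only [G, Finset.mem_filter, Nat.mem_primesLE, not_le]
      constructor
      · rintro ⟨⟨hpn, hpp⟩, h1, h2⟩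
        exact ⟨⟨Nat.le_floor h2, hpp⟩, (Nat.floor_lt hx0).mpr h1⟩
      · rintro ⟨⟨hpy, hpp⟩, hpx⟩
        have hpy' : (p : ℝ) ≤ y := (Nat.le_floor_iff hy0).mp hpy
        have hpx' : x < p := (Nat.floor_lt hx0).mp hpx
        refine ⟨⟨?_, hpp⟩, hpx', hpy'⟩
        have hc1 : (1 : ℝ) ≤ c := by exact_mod_cast (Finset.mem_Icc.mp hc).1
        have hnk' : ((n - k : ℕ) : ℝ) ≤ n := by exact_mod_cast Nat.sub_le n k
        have : y ≤ n := (div_le_self (by positivity) hc1).trans hnk'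
        exact_mod_cast hpy'.trans this
    rw [hGeq]
    -- it remains: `Σ_{p ≤ ⌊x⌋, p ∈ primesLE ⌊y⌋} log p ≤ θ(x)`-sum... other direction needed:
    -- we need `Σ_{primesLE ⌊x⌋} ≤ Σ_{primesLE ⌊y⌋, p ≤ ⌊x⌋} + (stuff ≥ 0)`? No: we need
    -- `Σ_G ≤ (Σ_{≤⌊x⌋ part} + Σ_G) − Σ_{primesLE ⌊x⌋}`, i.e. `Σ_{primesLE ⌊x⌋} ≤ Σ_{p ∈ primesLE ⌊y⌋, p ≤ ⌊x⌋}`.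
    -- If `x ≤ y` these index sets coincide; if `y < x` then `G c = ∅`... handle both.
    have hxy : x ≤ y := by
      obtain ⟨hc1, hcq⟩ := Finset.mem_Icc.mp hc
      have h1 : c + 1 ≤ n / k := by omega
      have h2 : k * (c + 1) ≤ n := by
        have := (Nat.le_div_iff_mul_le hk).mp h1; rw [mul_comm]; exact this
      have h2R : (k : ℝ) * (c + 1) ≤ n := by exact_mod_cast h2
      have hc0 : (0 : ℝ) < c := by exact_mod_cast hc1
      have hknR : ((n - k : ℕ) : ℝ) = n - k := by
        rw [Nat.cast_sub (by omega)]
      rw [hx, hy, hknR, div_le_div_iff₀ (by positivity) hc0]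
      nlinarith
    have hxe : (Nat.primesLE ⌊y⌋₊).filter (fun p => p ≤ ⌊x⌋₊) = Nat.primesLE ⌊x⌋₊ := by
      ext p
      simp only [Finset.mem_filter, Nat.mem_primesLE]
      constructor
      · rintro ⟨⟨_, hpp⟩, hpx⟩; exact ⟨hpx, hpp⟩
      · rintro ⟨hpx, hpp⟩; exact ⟨⟨hpx.trans (Nat.floor_le_floor hxy), hpp⟩, hpx⟩
    rw [hxe]; linarith
  -- assemble: `θ(n) − θ_L = Σ_{non-divisors} ≤ Σ_c Σ_{G c} ≤ Σ_c (θ y_c − θ x_c)`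
  have h1 : ∑ p ∈ Nat.primesLE n \ L.primeFactors, Real.log p ≤
      ∑ p ∈ (Finset.Icc 1 (n / k - 1)).biUnion G, Real.log p :=
    Finset.sum_le_sum_of_subset_of_nonneg hcover fun p _ _ => Real.log_natCast_nonneg p
  have h2 : ∑ p ∈ (Finset.Icc 1 (n / k - 1)).biUnion G, Real.log p ≤
      ∑ c ∈ Finset.Icc 1 (n / k - 1), ∑ p ∈ G c, Real.log p :=
    sum_biUnion_le_sum _ G _ fun p => Real.log_natCast_nonneg p
  have h3 := Finset.sum_le_sum hG
  linarith


/-- The bookkeeping inequality behind the error term of the lower bound. [folklore] -/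
theorem lemma48_errorBound' {η ε n k q H Q : ℝ} (hη0 : 0 < η) (hn0 : 0 < n)
    (hk0 : 0 ≤ k) (hq1 : 1 ≤ q) (hH0 : 0 ≤ H) (hHQ : H ≤ Q)
    (hηQ : η * Q = ε / 4) (hQ1 : 1 ≤ Q) :
    H * k + n / q - ε * n ≤
      (1 - η) * n - ((1 + η) * ((n - k) * H) - (1 - η) * (n * (H + 1 / q - 1))) := by
  have hid : (1 - η) * n - ((1 + η) * ((n - k) * H) - (1 - η) * (n * (H + 1 / q - 1))) =
      H * k + n / q - η * ((n - k) * H + n * H + n / q) := by ring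
  rw [hid]
  have hq0 : 0 < q := by linarith
  have h1q : n / q ≤ n := div_le_self hn0.le hq1
  have e1 : (n - k) * H ≤ n * Q := by nlinarith
  have e2 : n * H ≤ n * Q := mul_le_mul_of_nonneg_left hHQ hn0.le
  have e3 : η * ((n - k) * H + n * H + n / q) ≤ η * (n * Q + n * Q + n * Q) := by
    refine mul_le_mul_of_nonneg_left ?_ hη0.le
    nlinarith
  have e4 : η * (n * Q + n * Q + n * Q) = 3 * (ε / 4) * n := by
    rw [show η * (n * Q + n * Q + n * Q) = 3 * (η * Q) * n by ring, hηQ]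
  have hε : 0 < ε := by
    have : 0 < η * Q := mul_pos hη0 (by linarith)
    linarith
  nlinarith

/-- **CDT Lemma 48 (lower bound), uniformly in the range `⌊n/k⌋ ≤ Q`**: for every `Q ≥ 1` and
`ε > 0` there is `N₀` such that for all `n ≥ N₀`, `1 ≤ k < n` with `⌊n/k⌋ ≤ Q`,
`H_{q−1}·k + n/q − ε n ≤ log lcm(n−k, …, n)`, `q = ⌊n/k⌋`.
[cite: CalegariDimitrovTang2024, §5 Lemma 48 (1) (p. 43)] -/
theorem le_log_lcmIcc (Q : ℕ) (hQ : 1 ≤ Q) {ε : ℝ} (hε : 0 < ε) :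
    ∃ N₀ : ℕ, ∀ n k : ℕ, N₀ ≤ n → 1 ≤ k → k < n → n / k ≤ Q →
      (harmonic (n / k - 1) : ℝ) * k + (n : ℝ) / (n / k : ℕ) - ε * n ≤
        Real.log (lcmIcc (n - k) n) := by
  obtain ⟨η, hη⟩ : ∃ η : ℝ, η = ε / (4 * Q) := ⟨_, rfl⟩
  have hQ0 : (0 : ℝ) < Q := by exact_mod_cast hQ
  have hη0 : 0 < η := by rw [hη]; positivity
  obtain ⟨X₁, hX₁⟩ := Filter.eventually_atTop.mp (eventually_mul_le_theta hη0)
  obtain ⟨X₂, hX₂⟩ := Filter.eventually_atTop.mp (eventually_theta_le_mul hη0)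
  set X : ℝ := max X₁ X₂ with hX
  refine ⟨⌈(Q : ℝ) * (|X| + 1)⌉₊, ?_⟩
  intro n k hn hk hkn hqQ
  obtain ⟨q, hq⟩ : ∃ q : ℕ, q = n / k := ⟨_, rfl⟩
  rw [← hq] at hqQ
  have hnR1 : (Q : ℝ) * (|X| + 1) ≤ n := (Nat.le_ceil _).trans (by exact_mod_cast hn)
  have hq1 : 1 ≤ q := hq ▸ (Nat.one_le_div_iff (by omega)).mpr hkn.le
  have hqQ' : (q : ℝ) ≤ Q := by exact_mod_cast hqQ
  have hq0 : (0 : ℝ) < q := by exact_mod_cast hq1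
  have hk0 : (0 : ℝ) < k := by exact_mod_cast hk
  have hn0 : (0 : ℝ) < n := by exact_mod_cast (show 0 < n by omega)
  have hnk1 : 1 ≤ n - k := by omega
  have hnkR : ((n - k : ℕ) : ℝ) = n - k := by push_cast [Nat.cast_sub hkn.le]; ring
  have hkq : (k : ℝ) * q ≤ n := by
    have : q * k ≤ n := hq ▸ Nat.div_mul_le_self n k
    rw [mul_comm]; exact_mod_cast this
  have hXle : |X| + 1 ≤ (n : ℝ) / Q := by rw [le_div_iff₀ hQ0]; linarith
  have hXabs : X ≤ |X| := le_abs_self X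
  have hbig : ∀ t : ℝ, (n : ℝ) / Q - 1 ≤ t → X ≤ t := fun t ht => by linarith
  have hX1 : ∀ t, X ≤ t → (1 - η) * t ≤ Chebyshev.theta t := fun t ht =>
    hX₁ t ((le_max_left _ _).trans ht)
  have hX2 : ∀ t, X ≤ t → Chebyshev.theta t ≤ (1 + η) * t := fun t ht =>
    hX₂ t ((le_max_right _ _).trans ht)
  have hnq : (n : ℝ) / Q ≤ n := div_le_self hn0.le (by exact_mod_cast hQ)
  -- Step 1 + Step 2 (reverse)
  have h12 : Chebyshev.theta n - ∑ c ∈ Finset.Icc 1 (q - 1),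
      (Chebyshev.theta (((n - k : ℕ) : ℝ) / c) - Chebyshev.theta ((n : ℝ) / (c + 1))) ≤
      Real.log (lcmIcc (n - k) n) := by
    have h1 := theta_sub_le_thetaOf_lcmIcc n k hk hnk1
    rw [← hq] at h1
    exact h1.trans (thetaOf_le_log _)
  -- bound the gap sum from above
  have hgap : ∀ c ∈ Finset.Icc 1 (q - 1),
      Chebyshev.theta (((n - k : ℕ) : ℝ) / c) - Chebyshev.theta ((n : ℝ) / (c + 1)) ≤
      (1 + η) * (((n - k : ℕ) : ℝ) / c) - (1 - η) * ((n : ℝ) / (c + 1)) := by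
    intro c hc
    obtain ⟨hc1, hcq⟩ := Finset.mem_Icc.mp hc
    have hc0 : (0 : ℝ) < c := by exact_mod_cast hc1
    have hcq' : (c : ℝ) ≤ q - 1 := by
      have : c + 1 ≤ q := by omega
      have : ((c + 1 : ℕ) : ℝ) ≤ q := by exact_mod_cast this
      push_cast at this; linarith
    have hy : (n : ℝ) / Q - 1 ≤ ((n - k : ℕ) : ℝ) / c := by
      rw [hnkR]
      have h1 : (n : ℝ) / Q ≤ (n : ℝ) / q := div_le_div_of_nonneg_left hn0.le hq0 hqQ'
      have h2 : (n : ℝ) / q ≤ (n - k) / c := by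
        rw [div_le_div_iff₀ hq0 hc0]; nlinarith
      linarith
    have hx : (n : ℝ) / Q - 1 ≤ (n : ℝ) / (c + 1) := by
      have hc1' : (0 : ℝ) < c + 1 := by positivity
      have h1 : (n : ℝ) / Q ≤ (n : ℝ) / q := div_le_div_of_nonneg_left hn0.le hq0 hqQ'
      have h2 : (n : ℝ) / q ≤ (n : ℝ) / (c + 1) :=
        div_le_div_of_nonneg_left hn0.le hc1' (by linarith)
      linarith
    have := hX2 _ (hbig _ hy)
    have := hX1 _ (hbig _ hx)
    linarith
  have hsum := Finset.sum_le_sum hgap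
  obtain ⟨H, hHdef⟩ : ∃ H : ℝ, H = (harmonic (q - 1) : ℝ) := ⟨_, rfl⟩
  have hS1 : ∑ c ∈ Finset.Icc 1 (q - 1), (1 / (c : ℝ)) = H := by
    rw [hHdef]; exact sum_Icc_inv_eq_harmonic (q - 1)
  have hq1R : ((q - 1 : ℕ) : ℝ) = q - 1 := by rw [Nat.cast_sub hq1]; push_cast; ring
  have hS2 : ∑ c ∈ Finset.Icc 1 (q - 1), (1 / ((c : ℝ) + 1)) = H + 1 / q - 1 := by
    have htel := sum_Icc_inv_succ_sub_inv (q - 1)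
    rw [Finset.sum_sub_distrib, hS1, hq1R, sub_add_cancel] at htel
    linarith
  have hmain : ∑ c ∈ Finset.Icc 1 (q - 1),
      ((1 + η) * (((n - k : ℕ) : ℝ) / c) - (1 - η) * ((n : ℝ) / (c + 1))) =
      (1 + η) * ((n - k) * H) - (1 - η) * (n * (H + 1 / q - 1)) := by
    have e1 : ∀ c ∈ Finset.Icc 1 (q - 1),
        ((1 + η) * (((n - k : ℕ) : ℝ) / c) - (1 - η) * ((n : ℝ) / (c + 1))) =
        (1 + η) * (n - k) * (1 / (c : ℝ)) - (1 - η) * n * (1 / ((c : ℝ) + 1)) := by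
      intro c _
      rw [hnkR]; ring
    rw [Finset.sum_congr rfl e1, Finset.sum_sub_distrib, ← Finset.mul_sum, ← Finset.mul_sum,
      hS1, hS2]
    ring
  have hH0 : 0 ≤ H := by
    rw [← hS1]; exact Finset.sum_nonneg fun c _ => by positivity
  have hHq : H ≤ Q := by
    rw [← hS1]
    calc ∑ c ∈ Finset.Icc 1 (q - 1), (1 / (c : ℝ)) ≤ ∑ c ∈ Finset.Icc 1 (q - 1), (1 : ℝ) := by
          refine Finset.sum_le_sum fun c hc => ?_
          have : (1 : ℝ) ≤ c := by exact_mod_cast (Finset.mem_Icc.mp hc).1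
          exact (div_le_one (by linarith)).mpr this
      _ = q - 1 := by simp [hq1R]
      _ ≤ Q := by linarith
  have hkn' : (k : ℝ) ≤ n := by exact_mod_cast hkn.le
  have hA : (1 - η) * n ≤ Chebyshev.theta n := hX1 n (hbig n (by linarith))
  have hq1' : (1 : ℝ) ≤ q := by exact_mod_cast hq1
  have hηQ : η * Q = ε / 4 := by rw [hη]; field_simp
  have herr := lemma48_errorBound' (k := (k : ℝ)) hη0 hn0 hk0.le hq1' hH0 hHq hηQ
    (by exact_mod_cast hQ)
  calc (harmonic (n / k - 1) : ℝ) * k + (n : ℝ) / (n / k : ℕ) - ε * n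
      = H * k + n / q - ε * n := by rw [hHdef, hq]
    _ ≤ (1 - η) * n - ((1 + η) * ((n - k) * H) - (1 - η) * (n * (H + 1 / q - 1))) := herr
    _ = (1 - η) * n - ∑ c ∈ Finset.Icc 1 (q - 1),
          ((1 + η) * (((n - k : ℕ) : ℝ) / c) - (1 - η) * ((n : ℝ) / (c + 1))) := by rw [hmain]
    _ ≤ Chebyshev.theta n - ∑ c ∈ Finset.Icc 1 (q - 1),
          (Chebyshev.theta (((n - k : ℕ) : ℝ) / c) - Chebyshev.theta ((n : ℝ) / (c + 1))) := by
        linarith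
    _ ≤ Real.log (lcmIcc (n - k) n) := h12

/-- The main term is small for small `k`: `H_{q−1} k + n/q ≤ 4 n/√(Q+1)` when
`q = ⌊n/k⌋ ≥ Q + 1` (using `H_{q−1} ≤ 1 + log q ≤ 1 + 2√q` and `q k ≤ n`). [folklore] -/
theorem mainTerm_le_of_lt {n k Q : ℕ} (hk : 1 ≤ k) (hkn : k ≤ n) (hq : Q < n / k) :
    (harmonic (n / k - 1) : ℝ) * k + (n : ℝ) / (n / k : ℕ) ≤ 4 * n / Real.sqrt (Q + 1) := by
  obtain ⟨q, hqd⟩ : ∃ q : ℕ, q = n / k := ⟨_, rfl⟩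
  rw [← hqd] at hq ⊢
  have hq1 : 1 ≤ q := by omega
  have hq0 : (0 : ℝ) < q := by exact_mod_cast (show 0 < q by omega)
  have hk0 : (0 : ℝ) < k := by exact_mod_cast hk
  have hn0 : (0 : ℝ) < n := by exact_mod_cast (show 0 < n by omega)
  have hQ1 : (0 : ℝ) < (Q : ℝ) + 1 := by positivity
  have hQq : (Q : ℝ) + 1 ≤ q := by exact_mod_cast (show Q + 1 ≤ q by omega)
  have hkq : (k : ℝ) * q ≤ n := by
    have : q * k ≤ n := hqd ▸ Nat.div_mul_le_self n k
    rw [mul_comm]; exact_mod_cast this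
  -- `k ≤ n/(Q+1)`
  have hkQ : (k : ℝ) ≤ n / (Q + 1) := by
    rw [le_div_iff₀ hQ1]; nlinarith
  -- `H_{q−1} ≤ 1 + log q ≤ 1 + 2 √q`
  have hH : (harmonic (q - 1) : ℝ) ≤ 1 + 2 * Real.sqrt q := by
    have h1 : (harmonic (q - 1) : ℝ) ≤ 1 + Real.log ((q - 1 : ℕ) : ℝ) := harmonic_le_one_add_log _
    have h2 : Real.log ((q - 1 : ℕ) : ℝ) ≤ Real.log q := by
      rcases eq_or_lt_of_le hq1 with h | h
      · subst h; simp
      · exact Real.log_le_log (by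
          have : (1 : ℝ) < q := by exact_mod_cast h
          rw [Nat.cast_sub hq1]; push_cast; linarith) (by
          rw [Nat.cast_sub hq1]; push_cast; linarith)
    have h3 : Real.log q ≤ 2 * Real.sqrt q := by
      have := Real.log_le_rpow_div hq0.le (show (0 : ℝ) < 1 / 2 by norm_num)
      rw [← Real.sqrt_eq_rpow] at this
      linarith
    linarith
  -- `√q · k ≤ √n · √k ≤ n / √(Q+1)`
  have hsq1 : Real.sqrt q * k ≤ Real.sqrt n * Real.sqrt k := by
    have h1 : Real.sqrt q * Real.sqrt k = Real.sqrt (q * k) := (Real.sqrt_mul hq0.le _).symm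
    have h2 : Real.sqrt (q * k) ≤ Real.sqrt n := Real.sqrt_le_sqrt (by nlinarith)
    calc Real.sqrt q * k = Real.sqrt q * Real.sqrt k * Real.sqrt k := by
          rw [mul_assoc, Real.mul_self_sqrt hk0.le]
      _ = Real.sqrt (q * k) * Real.sqrt k := by rw [h1]
      _ ≤ Real.sqrt n * Real.sqrt k := mul_le_mul_of_nonneg_right h2 (Real.sqrt_nonneg _)
  have hsq2 : Real.sqrt n * Real.sqrt k ≤ n / Real.sqrt (Q + 1) := by
    have h1 : Real.sqrt k ≤ Real.sqrt (n / (Q + 1)) := Real.sqrt_le_sqrt hkQ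
    have h2 : Real.sqrt (n / (Q + 1)) = Real.sqrt n / Real.sqrt (Q + 1) := Real.sqrt_div' _ hQ1.le
    have h3 : Real.sqrt n * Real.sqrt n = n := Real.mul_self_sqrt hn0.le
    calc Real.sqrt n * Real.sqrt k ≤ Real.sqrt n * (Real.sqrt n / Real.sqrt (Q + 1)) := by
          rw [← h2]; exact mul_le_mul_of_nonneg_left h1 (Real.sqrt_nonneg _)
      _ = n / Real.sqrt (Q + 1) := by rw [mul_div_assoc', h3]
  have hsQ : 0 < Real.sqrt (Q + 1) := Real.sqrt_pos.mpr hQ1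
  -- `n/q ≤ n/(Q+1) ≤ n/√(Q+1)` and `k ≤ n/(Q+1) ≤ n/√(Q+1)`
  have hsqle : Real.sqrt ((Q : ℝ) + 1) ≤ Q + 1 := by
    have := Real.sqrt_le_sqrt (show (Q : ℝ) + 1 ≤ (Q + 1) ^ 2 by nlinarith)
    rwa [Real.sqrt_sq hQ1.le] at this
  have h1 : (n : ℝ) / q ≤ n / Real.sqrt (Q + 1) :=
    div_le_div_of_nonneg_left hn0.le hsQ (hsqle.trans hQq)
  have h2 : (k : ℝ) ≤ n / Real.sqrt (Q + 1) :=
    hkQ.trans (div_le_div_of_nonneg_left hn0.le hsQ hsqle)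
  calc (harmonic (q - 1) : ℝ) * k + (n : ℝ) / q
      ≤ (1 + 2 * Real.sqrt q) * k + n / q := by
        have := mul_le_mul_of_nonneg_right hH hk0.le; linarith
    _ = k + 2 * (Real.sqrt q * k) + n / q := by ring
    _ ≤ n / Real.sqrt (Q + 1) + 2 * (n / Real.sqrt (Q + 1)) + n / Real.sqrt (Q + 1) := by
        linarith [hsq1.trans hsq2]
    _ = 4 * n / Real.sqrt (Q + 1) := by ring

/-- **CDT Lemma 48 (1), lower half, uniformly in `0 ≤ k < n`**: for every `ε > 0` there is `N₀`
with `H_{⌊n/k⌋−1}·k + n/⌊n/k⌋ − ε n ≤ log lcm(n−k, …, n)` for all `n ≥ N₀`, `k < n`. Together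
with `log_lcmIcc_le_uniform`: `log L_{n,k} = (Σ_{h=1}^{⌊1/γ⌋−1} 1/h) k + ⌊1/γ⌋⁻¹ n + o(n)`
uniformly in `γ = k/n ∈ [0, 1)`. [cite: CalegariDimitrovTang2024, §5 Lemma 48 (1) (p. 43)] -/
theorem le_log_lcmIcc_uniform {ε : ℝ} (hε : 0 < ε) :
    ∃ N₀ : ℕ, ∀ n k : ℕ, N₀ ≤ n → k < n →
      (harmonic (n / k - 1) : ℝ) * k + (n : ℝ) / (n / k : ℕ) - ε * n ≤
        Real.log (lcmIcc (n - k) n) := by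
  -- `Q` with `4/√(Q+1) ≤ ε`
  set Q : ℕ := ⌈16 / ε ^ 2⌉₊ + 1 with hQdef
  have hQ1 : 1 ≤ Q := by omega
  have hQR : 16 / ε ^ 2 ≤ Q := (Nat.le_ceil _).trans (by rw [hQdef]; push_cast; linarith)
  obtain ⟨N₁, hN₁⟩ := le_log_lcmIcc Q hQ1 hε
  refine ⟨max N₁ 1, ?_⟩
  intro n k hn hkn
  have hn1 : N₁ ≤ n := le_of_max_le_left hn
  have hn0 : (0 : ℝ) < n := by exact_mod_cast (show 0 < n by omega)
  have hlog0 : 0 ≤ Real.log (lcmIcc (n - k) n) := by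
    have h0 : lcmIcc (n - k) n ≠ 0 := lcmIcc_ne_zero (by omega)
    exact Real.log_nonneg (by exact_mod_cast Nat.one_le_iff_ne_zero.mpr h0)
  rcases Nat.eq_zero_or_pos k with rfl | hk
  · simp only [Nat.div_zero, CharP.cast_eq_zero, mul_zero, zero_add, div_zero, zero_sub]
    nlinarith
  by_cases hq : n / k ≤ Q
  · exact hN₁ n k hn1 hk hkn hq
  · push Not at hq
    have hmain := mainTerm_le_of_lt hk hkn.le hq
    -- `4 n/√(Q+1) ≤ ε n`
    have hQ1R : (0 : ℝ) < (Q : ℝ) + 1 := by positivity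
    have hsQ : 0 < Real.sqrt (Q + 1) := Real.sqrt_pos.mpr hQ1R
    have h16 : 16 / ε ^ 2 ≤ (Q : ℝ) + 1 := by linarith
    have hsq : 4 / ε ≤ Real.sqrt (Q + 1) := by
      have h1 : Real.sqrt (16 / ε ^ 2) = 4 / ε := by
        rw [show (16 : ℝ) / ε ^ 2 = (4 / ε) ^ 2 by ring, Real.sqrt_sq (by positivity)]
      rw [← h1]; exact Real.sqrt_le_sqrt h16
    have hbd : 4 * (n : ℝ) / Real.sqrt (Q + 1) ≤ ε * n := by
      rw [div_le_iff₀ hsQ]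
      have : 4 * (n : ℝ) ≤ ε * Real.sqrt (Q + 1) * n := by
        have h2 : 4 ≤ ε * Real.sqrt (Q + 1) := by
          have := mul_le_mul_of_nonneg_left hsq hε.le
          rwa [mul_div_cancel₀ _ hε.ne'] at this
        nlinarith
      linarith
    linarith


end CalegariDimitrovTang

end Literature.NumberTheory.Transcendental
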